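import Mathlib.Analysis.Calculus.SmoothSeries
import Mathlib.Analysis.Calculus.IteratedDeriv.Lemmas
import Mathlib.Analysis.Calculus.Deriv.Pow
import Mathlib.Analysis.Calculus.Deriv.Inv
import Mathlib.Analysis.SpecificLimits.Normed
import Literature.Probability.RandomPlanarGeometry.RohdeSchrammGhat
import HarnessLib

/-!
# Rohde–Schramm's `Ĝ` solves the generator equation (6.9): `(κ/2) Ĝ'' + (4x/|z|²) Ĝ' + (4a y²/|z|⁴) Ĝ = 0`

Trunk T-STOCH; layer 5c (real analysis) of the decomposition of the space-filling phase of SLE_κ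
(`Literature.Probability.RandomPlanarGeometry.ae_isSpaceFilling_sleTrace_of_eight_le`;
Rohde–Schramm, Ann. Math. 161 (2005), Cor. 7.4 + Update), serving the Itô step of **Lemma 6.3**
(`sle_martingale_rsObservable`, layer 4c): the drift of `Mₜ = ψₜ^a Ĝ(zₜ)` vanishes because `Ĝ`
satisfies Rohde–Schramm's equation (6.9) (p. 906),
`(4a y²/|z|⁴) Ĝ + (κ/2) ∂ₓ² Ĝ + (4x/|z|²) ∂ₓ Ĝ = 0` "for `y = 1`",
i.e., for the function of the slope `h(w) = Ĝ(w + i) = rsGhatW κ w = ₂F₁(η, η, 1/2, w²/(1+w²))`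
(`η = 1/2 - 2/κ`, exponent `a = a(κ) = -(κ-4)²/(8κ)` of layer 4b):

  `(κ/2) h''(w) + (4w/(1+w²)) h'(w) + (4a/(1+w²)²) h(w) = 0`     (`rsGhatW_ode`).

Everything is elementary real analysis, proved from Mathlib:
* the power series `F(r) = Σ cₙ rⁿ` of `₂F₁(η, η, 1/2, r)` (`cₙ = hypHalfCoeff η n`) is
  differentiated term-wise twice on `|r| < 1` (`hasDerivAt_tsum_of_isPreconnected`;
  `hasDerivAt_hypHalf`, `hasDerivAt_hypHalfDeriv`);
* the **hypergeometric equation** `r(1-r) F'' + (1/2 - (2η+1) r) F' - η² F = 0` follows from the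
  coefficient recursion `c_{n+1} = cₙ (η+n)²/((1/2+n)(n+1))` (`hypHalfCoeff_succ`, layer 4b) by
  telescoping (`hypHalf_ode`);
* the chain rule through `r(w) = w²/(1+w²)` and the identities `r'² = 4 r(1-r)/(1+w²)²`,
  `2κη² + 4a = 0`, `4κη - 2κ + 8 = 0` turn it into (6.9) (`rsGhatW_ode`); `h ∈ C²`
  (`contDiff_rsGhatW`, every order `n`), with `h'`, `h''` identified (`deriv_rsGhatW`, `deriv_deriv_rsGhatW`).

## References

* S. Rohde, O. Schramm, *Basic properties of SLE*, Ann. of Math. 161 (2005) 883–924: Lemma 6.3,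
  eq. (6.1) (p. 903), eq. (6.9) and the footnote on p. 904 (how `Ĝ` solves the ODE), p. 906.
-/

noncomputable section

open Set Filter Topology Metric

namespace Literature.Probability.RandomPlanarGeometry

/-! ### The power series of `₂F₁(η, η, 1/2, ·)` and its first two derivatives -/

section HypHalfSeries

variable {η : ℝ}

/-- `₂F₁(η, η, 1/2, r) = Σ cₙ rⁿ` for every real `r` (both sides with Mathlib's junk `0` for a
divergent series); eq. (6.1) of Rohde–Schramm (2005). [cite: RohdeSchramm2005, Lemma 6.3] -/
theorem hypHalf_eq_tsum (η r : ℝ) : ₂F₁ η η (1 / 2 : ℝ) r = ∑' n, hypHalfCoeff η n * r ^ n := by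
  rw [ordinaryHypergeometric_eq_tsum]
  simp only [smul_eq_mul, hypHalfCoeff, ordinaryHypergeometricCoefficient]

/-- `|cₙ| ≤ 1` for `0 < η ≤ 1/2`. [folklore] -/
theorem abs_hypHalfCoeff_le_one (hη : 0 < η) (hη' : η ≤ 1 / 2) (n : ℕ) : |hypHalfCoeff η n| ≤ 1 := by
  rw [abs_of_pos (hypHalfCoeff_pos hη n)]
  exact hypHalfCoeff_le_one hη hη' n

/-- The first term-wise derivative series: `F₁(r) = Σ cₙ n rⁿ⁻¹`. [folklore] -/
def hypHalfDeriv (η r : ℝ) : ℝ := ∑' n : ℕ, hypHalfCoeff η n * ((n : ℝ) * r ^ (n - 1))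

/-- The second term-wise derivative series: `F₂(r) = Σ cₙ n (n-1) rⁿ⁻²`. [folklore] -/
def hypHalfDeriv₂ (η r : ℝ) : ℝ :=
  ∑' n : ℕ, hypHalfCoeff η n * ((n : ℝ) * (((n - 1 : ℕ) : ℝ) * r ^ (n - 1 - 1)))

/-- `Σ (n+1) ρⁿ` and friends: `n ↦ n ρ^{n-1}` is summable for `0 ≤ ρ < 1`. [folklore] -/
theorem summable_mul_pow_pred {ρ : ℝ} (hρ0 : 0 ≤ ρ) (hρ : ρ < 1) :
    Summable fun n : ℕ ↦ (n : ℝ) * ρ ^ (n - 1) := by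
  have hρn : ‖ρ‖ < 1 := by rwa [Real.norm_eq_abs, abs_of_nonneg hρ0]
  rw [← summable_nat_add_iff 1]
  have h1 := summable_pow_mul_geometric_of_norm_lt_one 1 hρn
  have h0 := summable_geometric_of_lt_one hρ0 hρ
  simp only [pow_one] at h1
  refine (h1.add h0).congr fun n ↦ ?_
  simp only [Nat.add_sub_cancel]
  push_cast
  ring

/-- `n ↦ n (n-1) ρ^{n-2}` is summable for `0 ≤ ρ < 1`. [folklore] -/
theorem summable_mul_mul_pow_pred_pred {ρ : ℝ} (hρ0 : 0 ≤ ρ) (hρ : ρ < 1) :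
    Summable fun n : ℕ ↦ (n : ℝ) * (((n - 1 : ℕ) : ℝ) * ρ ^ (n - 1 - 1)) := by
  have hρn : ‖ρ‖ < 1 := by rwa [Real.norm_eq_abs, abs_of_nonneg hρ0]
  rw [← summable_nat_add_iff 2]
  have h2 := summable_pow_mul_geometric_of_norm_lt_one 2 hρn
  have h1 := summable_pow_mul_geometric_of_norm_lt_one 1 hρn
  have h0 := summable_geometric_of_lt_one hρ0 hρ
  simp only [pow_one] at h1
  refine ((h2.add (h1.mul_left 3)).add (h0.mul_left 2)).congr fun n ↦ ?_
  simp only [show n + 2 - 1 = n + 1 from rfl, Nat.add_sub_cancel]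
  push_cast
  ring

/-- The power series `Σ cₙ rⁿ` converges absolutely for `|r| < 1` (`0 < η ≤ 1/2`). [folklore] -/
theorem summable_hypHalf_term (hη : 0 < η) (hη' : η ≤ 1 / 2) {r : ℝ} (hr : |r| < 1) :
    Summable fun n ↦ hypHalfCoeff η n * r ^ n := by
  refine Summable.of_norm_bounded (g := fun n ↦ |r| ^ n)
    (summable_geometric_of_lt_one (abs_nonneg r) hr) fun n ↦ ?_
  rw [Real.norm_eq_abs, abs_mul, abs_pow]
  exact mul_le_of_le_one_left (pow_nonneg (abs_nonneg r) n) (abs_hypHalfCoeff_le_one hη hη' n)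

/-- **Term-wise differentiation of `₂F₁(η, η, 1/2, ·)`** on `|r| < 1` (`0 < η ≤ 1/2`):
`HasDerivAt (₂F₁ η η (1/2)) (F₁ r) r`, `F₁ = hypHalfDeriv`. [folklore] -/
theorem hasDerivAt_hypHalf (hη : 0 < η) (hη' : η ≤ 1 / 2) {r : ℝ} (hr : |r| < 1) :
    HasDerivAt (fun x ↦ ₂F₁ η η (1 / 2 : ℝ) x) (hypHalfDeriv η r) r := by
  obtain ⟨ρ, hrρ, hρ1⟩ := exists_between hr
  have hρ0 : 0 ≤ ρ := (abs_nonneg r).trans hrρ.le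
  have hρpos : 0 < ρ := (abs_nonneg r).trans_lt hrρ
  have hfun : (fun x ↦ ₂F₁ η η (1 / 2 : ℝ) x) = fun x ↦ ∑' n, hypHalfCoeff η n * x ^ n :=
    funext (hypHalf_eq_tsum η)
  rw [hfun, hypHalfDeriv]
  refine hasDerivAt_tsum_of_isPreconnected (u := fun n : ℕ ↦ (n : ℝ) * ρ ^ (n - 1))
    (t := Ioo (-ρ) ρ) (y₀ := 0) (summable_mul_pow_pred hρ0 hρ1) isOpen_Ioo
    (convex_Ioo _ _).isPreconnected (fun n y _ ↦ (hasDerivAt_pow n y).const_mul _)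
    (fun n y hy ↦ ?_) ⟨by linarith, hρpos⟩ ?_ (abs_lt.1 hrρ)
  · have hy' : |y| ≤ ρ := (abs_lt.2 hy).le
    rw [Real.norm_eq_abs, abs_mul, abs_mul, abs_pow, Nat.abs_cast]
    calc |hypHalfCoeff η n| * ((n : ℝ) * |y| ^ (n - 1)) ≤ 1 * ((n : ℝ) * ρ ^ (n - 1)) := by
          gcongr
          · exact abs_hypHalfCoeff_le_one hη hη' n
      _ = (n : ℝ) * ρ ^ (n - 1) := one_mul _
  · simpa using summable_hypHalf_term hη hη' (r := 0) (by simp)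

/-- **Term-wise differentiation of `F₁ = Σ cₙ n rⁿ⁻¹`** on `|r| < 1` (`0 < η ≤ 1/2`):
`HasDerivAt F₁ (F₂ r) r`, `F₂ = hypHalfDeriv₂`. [folklore] -/
theorem hasDerivAt_hypHalfDeriv (hη : 0 < η) (hη' : η ≤ 1 / 2) {r : ℝ} (hr : |r| < 1) :
    HasDerivAt (hypHalfDeriv η) (hypHalfDeriv₂ η r) r := by
  obtain ⟨ρ, hrρ, hρ1⟩ := exists_between hr
  have hρ0 : 0 ≤ ρ := (abs_nonneg r).trans hrρ.le
  have hρpos : 0 < ρ := (abs_nonneg r).trans_lt hrρ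
  unfold hypHalfDeriv hypHalfDeriv₂
  refine hasDerivAt_tsum_of_isPreconnected
    (u := fun n : ℕ ↦ (n : ℝ) * (((n - 1 : ℕ) : ℝ) * ρ ^ (n - 1 - 1)))
    (t := Ioo (-ρ) ρ) (y₀ := 0) (summable_mul_mul_pow_pred_pred hρ0 hρ1) isOpen_Ioo
    (convex_Ioo _ _).isPreconnected
    (fun n y _ ↦ ((hasDerivAt_pow (n - 1) y).const_mul _).const_mul _)
    (fun n y hy ↦ ?_) ⟨by linarith, hρpos⟩ ?_ (abs_lt.1 hrρ)
  · have hy' : |y| ≤ ρ := (abs_lt.2 hy).le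
    rw [Real.norm_eq_abs, abs_mul, abs_mul, abs_mul, abs_pow, Nat.abs_cast, Nat.abs_cast]
    calc |hypHalfCoeff η n| * ((n : ℝ) * (((n - 1 : ℕ) : ℝ) * |y| ^ (n - 1 - 1)))
        ≤ 1 * ((n : ℝ) * (((n - 1 : ℕ) : ℝ) * ρ ^ (n - 1 - 1))) := by
          gcongr
          · exact abs_hypHalfCoeff_le_one hη hη' n
      _ = (n : ℝ) * (((n - 1 : ℕ) : ℝ) * ρ ^ (n - 1 - 1)) := one_mul _
  · refine Summable.of_norm_bounded (g := fun n : ℕ ↦ (n : ℝ) * (0 : ℝ) ^ (n - 1))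
      (summable_mul_pow_pred le_rfl one_pos) fun n ↦ ?_
    rw [Real.norm_eq_abs, abs_mul, abs_mul, Nat.abs_cast]
    calc |hypHalfCoeff η n| * ((n : ℝ) * |(0 : ℝ) ^ (n - 1)|) ≤ 1 * ((n : ℝ) * |(0 : ℝ) ^ (n - 1)|) := by
          gcongr
          · exact abs_hypHalfCoeff_le_one hη hη' n
      _ = (n : ℝ) * (0 : ℝ) ^ (n - 1) := by
          rw [one_mul, abs_of_nonneg (pow_nonneg le_rfl _)]

/-- `HasSum (cₙ rⁿ) (₂F₁ η η (1/2) r)` for `|r| < 1`. [folklore] -/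
theorem hasSum_hypHalf' (hη : 0 < η) (hη' : η ≤ 1 / 2) {r : ℝ} (hr : |r| < 1) :
    HasSum (fun n ↦ hypHalfCoeff η n * r ^ n) (₂F₁ η η (1 / 2 : ℝ) r) := by
  rw [hypHalf_eq_tsum]
  exact (summable_hypHalf_term hη hη' hr).hasSum

/-- `HasSum (cₙ n rⁿ⁻¹) (F₁ r)` for `|r| < 1`. [folklore] -/
theorem hasSum_hypHalfDeriv (hη : 0 < η) (hη' : η ≤ 1 / 2) {r : ℝ} (hr : |r| < 1) :
    HasSum (fun n : ℕ ↦ hypHalfCoeff η n * ((n : ℝ) * r ^ (n - 1))) (hypHalfDeriv η r) := by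
  have hs : Summable fun n : ℕ ↦ hypHalfCoeff η n * ((n : ℝ) * r ^ (n - 1)) := by
    refine Summable.of_norm_bounded (summable_mul_pow_pred (abs_nonneg r) hr) fun n ↦ ?_
    rw [Real.norm_eq_abs, abs_mul, abs_mul, abs_pow, Nat.abs_cast]
    exact mul_le_of_le_one_left (by positivity) (abs_hypHalfCoeff_le_one hη hη' n)
  exact hs.hasSum

/-- `HasSum (cₙ n (n-1) rⁿ⁻²) (F₂ r)` for `|r| < 1`. [folklore] -/
theorem hasSum_hypHalfDeriv₂ (hη : 0 < η) (hη' : η ≤ 1 / 2) {r : ℝ} (hr : |r| < 1) :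
    HasSum (fun n : ℕ ↦ hypHalfCoeff η n * ((n : ℝ) * (((n - 1 : ℕ) : ℝ) * r ^ (n - 1 - 1))))
      (hypHalfDeriv₂ η r) := by
  have hs : Summable fun n : ℕ ↦
      hypHalfCoeff η n * ((n : ℝ) * (((n - 1 : ℕ) : ℝ) * r ^ (n - 1 - 1))) := by
    refine Summable.of_norm_bounded (summable_mul_mul_pow_pred_pred (abs_nonneg r) hr) fun n ↦ ?_
    rw [Real.norm_eq_abs, abs_mul, abs_mul, abs_mul, abs_pow, Nat.abs_cast, Nat.abs_cast]
    exact mul_le_of_le_one_left (by positivity) (abs_hypHalfCoeff_le_one hη hη' n)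
  exact hs.hasSum

/-- **The hypergeometric equation for `₂F₁(η, η, 1/2, ·)`**:
`r(1-r) F'' + (1/2 - (2η+1) r) F' - η² F = 0` on `|r| < 1` (`0 < η ≤ 1/2`; term-wise, the
coefficient of `rᵐ` is `(m+1)(m+1/2) c_{m+1} - (m+η)² cₘ = 0`, the recursion `hypHalfCoeff_succ`;
summed by telescoping). This is the ODE behind "`Ĝ` satisfies (6.9)" (Rohde–Schramm (2005),
p. 906, and the footnote on p. 904). [cite: RohdeSchramm2005, Lemma 6.3] -/
theorem hypHalf_ode (hη : 0 < η) (hη' : η ≤ 1 / 2) {r : ℝ} (hr : |r| < 1) :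
    r * (1 - r) * hypHalfDeriv₂ η r + (1 / 2 - (2 * η + 1) * r) * hypHalfDeriv η r -
      η ^ 2 * ₂F₁ η η (1 / 2 : ℝ) r = 0 := by
  set c : ℕ → ℝ := hypHalfCoeff η with hc
  have S0 := hasSum_hypHalf' hη hη' hr
  have S1 := hasSum_hypHalfDeriv hη hη' hr
  have S2 := hasSum_hypHalfDeriv₂ hη hη' hr
  -- the telescoping sequence `A` and its shift `B n = A (n+1)`
  set A : ℕ → ℝ := fun n ↦ c n * ((n : ℝ) * (((n - 1 : ℕ) : ℝ) + 1 / 2)) * r ^ (n - 1) with hA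
  set B : ℕ → ℝ := fun n ↦ c n * ((n : ℝ) + η) ^ 2 * r ^ n with hB
  have hAsum : HasSum A (r * hypHalfDeriv₂ η r + 1 / 2 * hypHalfDeriv η r) := by
    have h := (S2.mul_left r).add (S1.mul_left (1 / 2))
    have hfun : (fun n : ℕ ↦ r * (hypHalfCoeff η n * ((n : ℝ) * (((n - 1 : ℕ) : ℝ) * r ^ (n - 1 - 1)))) +
        1 / 2 * (hypHalfCoeff η n * ((n : ℝ) * r ^ (n - 1)))) = A := by
      funext n
      simp only [hA, hc]
      rcases n with _ | _ | m
      · simp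
      · simp
        ring
      · simp only [Nat.add_sub_cancel, show m + 2 - 1 = m + 1 from rfl]
        push_cast
        ring
    rwa [hfun] at h
  have hA0 : A 0 = 0 := by simp [hA]
  have hBA : ∀ n, B n = A (n + 1) := by
    intro n
    simp only [hA, hB, Nat.add_sub_cancel, hc, hypHalfCoeff_succ]
    have h1 : (1 / 2 + (n : ℝ)) ≠ 0 := by positivity
    have h2 : ((n : ℝ) + 1) ≠ 0 := by positivity
    push_cast
    field_simp
    ring
  have hBsum : HasSum B (r * hypHalfDeriv₂ η r + 1 / 2 * hypHalfDeriv η r) := by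
    have h := (hasSum_nat_add_iff' 1).2 hAsum
    rw [Finset.sum_range_one, hA0, sub_zero] at h
    have hfun : (fun n ↦ A (n + 1)) = B := funext fun n ↦ (hBA n).symm
    rwa [hfun] at h
  -- the left-hand side, summed term-wise, equals `Σ (A n - B n) = 0`
  have hT : HasSum (fun n ↦ A n - B n)
      (r * (1 - r) * hypHalfDeriv₂ η r + (1 / 2 - (2 * η + 1) * r) * hypHalfDeriv η r -
        η ^ 2 * ₂F₁ η η (1 / 2 : ℝ) r) := by
    have h := ((S2.mul_left (r * (1 - r))).add (S1.mul_left (1 / 2 - (2 * η + 1) * r))).sub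
      (S0.mul_left (η ^ 2))
    have hfun : (fun n : ℕ ↦
        r * (1 - r) * (hypHalfCoeff η n * ((n : ℝ) * (((n - 1 : ℕ) : ℝ) * r ^ (n - 1 - 1)))) +
          (1 / 2 - (2 * η + 1) * r) * (hypHalfCoeff η n * ((n : ℝ) * r ^ (n - 1))) -
          η ^ 2 * (hypHalfCoeff η n * r ^ n)) = fun n ↦ A n - B n := by
      funext n
      simp only [hA, hB, hc]
      rcases n with _ | _ | m
      · simp
        ring
      · simp
        ring
      · simp only [Nat.add_sub_cancel, show m + 2 - 1 = m + 1 from rfl]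
        push_cast
        ring
    rwa [hfun] at h
  have h0 : HasSum (fun n ↦ A n - B n) 0 := by
    simpa using hAsum.sub hBsum
  exact hT.unique h0

end HypHalfSeries

/-! ### The slope map `r(w) = w²/(1+w²)` and the derivatives of `Ĝ(w + i) = rsGhatW κ w` -/

section Slope

/-- The slope argument `r(w) = w²/(1+w²)`. [folklore] -/
def slopeArg (w : ℝ) : ℝ := w ^ 2 / (1 + w ^ 2)

/-- `r'(w) = 2w/(1+w²)²`. [folklore] -/
theorem hasDerivAt_slopeArg (w : ℝ) : HasDerivAt slopeArg (2 * w / (1 + w ^ 2) ^ 2) w := by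
  have hP : (1 + w ^ 2) ≠ 0 := by positivity
  have h1 : HasDerivAt (fun w : ℝ ↦ w ^ 2) (2 * w) w := by simpa using hasDerivAt_pow 2 w
  have h2 : HasDerivAt (fun w : ℝ ↦ 1 + w ^ 2) (2 * w) w := by simpa using h1.const_add 1
  refine (h1.div h2 hP).congr_deriv ?_
  rw [div_eq_div_iff (pow_ne_zero 2 hP) (pow_ne_zero 2 hP)]
  ring

/-- `r''(w) = (2 - 6w²)/(1+w²)³`. [folklore] -/
theorem hasDerivAt_deriv_slopeArg (w : ℝ) :
    HasDerivAt (fun w : ℝ ↦ 2 * w / (1 + w ^ 2) ^ 2) ((2 - 6 * w ^ 2) / (1 + w ^ 2) ^ 3) w := by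
  have hP1 : (1 + w ^ 2) ≠ 0 := by positivity
  have hP : (1 + w ^ 2) ^ 2 ≠ 0 := by positivity
  have h1 : HasDerivAt (fun w : ℝ ↦ 2 * w) 2 w := by simpa using (hasDerivAt_id w).const_mul 2
  have h2' : HasDerivAt (fun w : ℝ ↦ 1 + w ^ 2) (2 * w) w := by
    simpa using (hasDerivAt_pow 2 w).const_add 1
  have h2 := (hasDerivAt_pow 2 (1 + w ^ 2)).comp w h2'
  refine (h1.div h2 hP).congr_deriv ?_
  simp only [Function.comp_def]
  rw [div_eq_div_iff (pow_ne_zero 2 hP) (pow_ne_zero 3 hP1)]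
  push_cast
  ring

/-- `|r(w)| < 1`. [folklore] -/
theorem abs_slopeArg_lt_one (w : ℝ) : |slopeArg w| < 1 := by
  rw [slopeArg, abs_of_nonneg (slopeArg_nonneg w)]
  exact slopeArg_lt_one w

variable {κ : ℝ}

/-- `η(κ) > 0` for `κ > 4`. [folklore] -/
theorem rsEta_pos (hκ : 4 < κ) : 0 < rsEta κ := by
  rw [rsEta, sub_pos, div_lt_iff₀ (by linarith)]
  linarith

/-- `rsGhatW κ = ₂F₁(η, η, 1/2, ·) ∘ r`. [folklore] -/
theorem rsGhatW_eq_comp (κ : ℝ) :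
    rsGhatW κ = (fun x ↦ ₂F₁ (rsEta κ) (rsEta κ) (1 / 2 : ℝ) x) ∘ slopeArg := by
  funext w
  rfl

/-- **`h'(w) = F₁(r(w)) r'(w)`** for `h = rsGhatW κ`, `κ > 4` (chain rule through the power
series). [folklore] -/
theorem hasDerivAt_rsGhatW (hκ : 4 < κ) (w : ℝ) :
    HasDerivAt (rsGhatW κ)
      (hypHalfDeriv (rsEta κ) (slopeArg w) * (2 * w / (1 + w ^ 2) ^ 2)) w := by
  rw [rsGhatW_eq_comp]
  exact (hasDerivAt_hypHalf (rsEta_pos hκ) (rsEta_lt_half (by linarith)).le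
    (abs_slopeArg_lt_one w)).comp w (hasDerivAt_slopeArg w)

/-- `deriv (rsGhatW κ) = fun w ↦ F₁(r w) r'(w)` (`κ > 4`). [folklore] -/
theorem deriv_rsGhatW (hκ : 4 < κ) :
    deriv (rsGhatW κ) = fun w ↦ hypHalfDeriv (rsEta κ) (slopeArg w) * (2 * w / (1 + w ^ 2) ^ 2) :=
  funext fun w ↦ (hasDerivAt_rsGhatW hκ w).deriv

/-- **`h''(w) = F₂(r) r'² + F₁(r) r''`** for `h = rsGhatW κ`, `κ > 4`. [folklore] -/
theorem hasDerivAt_deriv_rsGhatW (hκ : 4 < κ) (w : ℝ) :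
    HasDerivAt (deriv (rsGhatW κ))
      (hypHalfDeriv₂ (rsEta κ) (slopeArg w) * (2 * w / (1 + w ^ 2) ^ 2) * (2 * w / (1 + w ^ 2) ^ 2) +
        hypHalfDeriv (rsEta κ) (slopeArg w) * ((2 - 6 * w ^ 2) / (1 + w ^ 2) ^ 3)) w := by
  rw [deriv_rsGhatW hκ]
  have h1 : HasDerivAt (fun w ↦ hypHalfDeriv (rsEta κ) (slopeArg w))
      (hypHalfDeriv₂ (rsEta κ) (slopeArg w) * (2 * w / (1 + w ^ 2) ^ 2)) w :=
    (hasDerivAt_hypHalfDeriv (rsEta_pos hκ) (rsEta_lt_half (by linarith)).le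
      (abs_slopeArg_lt_one w)).comp w (hasDerivAt_slopeArg w)
  exact h1.mul (hasDerivAt_deriv_slopeArg w)

/-- `deriv (deriv (rsGhatW κ)) w = F₂(r) r'² + F₁(r) r''` (`κ > 4`). [folklore] -/
theorem deriv_deriv_rsGhatW (hκ : 4 < κ) (w : ℝ) :
    deriv (deriv (rsGhatW κ)) w =
      hypHalfDeriv₂ (rsEta κ) (slopeArg w) * (2 * w / (1 + w ^ 2) ^ 2) * (2 * w / (1 + w ^ 2) ^ 2) +
        hypHalfDeriv (rsEta κ) (slopeArg w) * ((2 - 6 * w ^ 2) / (1 + w ^ 2) ^ 3) :=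
  (hasDerivAt_deriv_rsGhatW hκ w).deriv

/-- **Rohde–Schramm's equation (6.9) for `Ĝ` at `y = 1`**: with `h = rsGhatW κ` (`= Ĝ(w + i)`),
`a = rsExponent κ` and `κ > 4`,
`(κ/2) h''(w) + (4w/(1+w²)) h'(w) + (4a/(1+w²)²) h(w) = 0` for every real `w`
("Since `Ĝ` satisfies `(4a y²/|z|⁴) Ĝ + (κ/2) ∂ₓ²Ĝ + (4x/|z|²) ∂ₓĜ = 0` for `y = 1`", p. 906).
From the hypergeometric equation `hypHalf_ode` through `r = w²/(1+w²)`, `r'² = 4r(1-r)/(1+w²)²`,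
and the identities `2κη² + 4a = 0`, `4κη - 2κ + 8 = 0`. [cite: RohdeSchramm2005, Lemma 6.3] -/
theorem rsGhatW_ode (hκ : 4 < κ) (w : ℝ) :
    κ / 2 * deriv (deriv (rsGhatW κ)) w + 4 * w / (1 + w ^ 2) * deriv (rsGhatW κ) w +
      4 * rsExponent κ / (1 + w ^ 2) ^ 2 * rsGhatW κ w = 0 := by
  have hκ0 : κ ≠ 0 := by positivity
  have hη : 0 < rsEta κ := rsEta_pos hκ
  have hη' : rsEta κ ≤ 1 / 2 := (rsEta_lt_half (by linarith)).le
  have hode := hypHalf_ode hη hη' (abs_slopeArg_lt_one w)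
  rw [deriv_deriv_rsGhatW hκ, deriv_rsGhatW hκ]
  beta_reduce
  have hG : rsGhatW κ w = ₂F₁ (rsEta κ) (rsEta κ) (1 / 2 : ℝ) (slopeArg w) := rfl
  rw [hG]
  set X := hypHalfDeriv₂ (rsEta κ) (slopeArg w)
  set Y := hypHalfDeriv (rsEta κ) (slopeArg w)
  set Z := ₂F₁ (rsEta κ) (rsEta κ) (1 / 2 : ℝ) (slopeArg w)
  simp only [slopeArg, rsEta, rsExponent] at hode ⊢
  have hP : (1 + w ^ 2) ≠ 0 := by positivity
  field_simp at hode
  field_simp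
  linear_combination 8 * hode

/-! ### `Ĝ(· + i)` is smooth -/

/-- `₂F₁(η, η, 1/2, ·)` is `Cⁿ` (indeed analytic) at every `|x| < 1` (`η > 0`): the radius of
convergence of the hypergeometric series is `1` (Mathlib
`ordinaryHypergeometricSeries_radius_eq_one`). [folklore] -/
theorem contDiffAt_hypHalf {η : ℝ} (hη : 0 < η) {x : ℝ} (hx : |x| < 1) {n : WithTop ℕ∞} :
    ContDiffAt ℝ n (fun y ↦ ₂F₁ η η (1 / 2 : ℝ) y) x := by
  set p := ordinaryHypergeometricSeries ℝ η η (1 / 2 : ℝ) with hp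
  have hrad : p.radius = 1 := by
    refine ordinaryHypergeometricSeries_radius_eq_one ℝ η η (1 / 2 : ℝ) fun kn ↦ ⟨?_, ?_, ?_⟩
    · have := Nat.cast_nonneg (α := ℝ) kn; intro h; linarith
    · have := Nat.cast_nonneg (α := ℝ) kn; intro h; linarith
    · have := Nat.cast_nonneg (α := ℝ) kn; intro h; linarith
  have hps : HasFPowerSeriesOnBall (fun y ↦ ₂F₁ η η (1 / 2 : ℝ) y) p 0 1 := by
    have h := p.hasFPowerSeriesOnBall (by rw [hrad]; exact one_pos)
    rwa [hrad] at h
  have hxmem : x ∈ Metric.eball (0 : ℝ) 1 := by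
    rw [← ENNReal.ofReal_one, Metric.eball_ofReal, mem_ball_zero_iff, Real.norm_eq_abs]
    exact hx
  exact (hps.analyticAt_of_mem hxmem).contDiffAt

/-- The slope map `w ↦ w²/(1+w²)` is smooth. [folklore] -/
theorem contDiff_slopeArg {n : WithTop ℕ∞} : ContDiff ℝ n slopeArg :=
  (contDiff_id.pow 2).div (contDiff_const.add (contDiff_id.pow 2)) fun w ↦ by positivity

/-- **`h = rsGhatW κ` is `Cⁿ` for every `n`** (`κ > 4`), in particular `C²` as Itô's formula
requires. [folklore] -/
theorem contDiff_rsGhatW (hκ : 4 < κ) {n : WithTop ℕ∞} : ContDiff ℝ n (rsGhatW κ) := by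
  rw [rsGhatW_eq_comp, contDiff_iff_contDiffAt]
  intro w
  exact (contDiffAt_hypHalf (rsEta_pos hκ) (abs_slopeArg_lt_one w)).comp w
    contDiff_slopeArg.contDiffAt

/-- `iteratedDeriv 2 (rsGhatW κ) = deriv (deriv (rsGhatW κ))`, the form in which the second
derivative enters `Literature.Analysis.FunctionSpaces.ito_formula_itoProcess_ae`. [folklore] -/
theorem iteratedDeriv_two_rsGhatW (κ : ℝ) :
    iteratedDeriv 2 (rsGhatW κ) = deriv (deriv (rsGhatW κ)) := by
  rw [iteratedDeriv_succ, iteratedDeriv_one]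

/-- **(6.9) with `iteratedDeriv`**: `(κ/2) h⁽²⁾(w) + (4w/(1+w²)) h'(w) + (4a/(1+w²)²) h(w) = 0`,
`h = rsGhatW κ`, `a = rsExponent κ`, `κ > 4`. [cite: RohdeSchramm2005, Lemma 6.3] -/
theorem rsGhatW_ode' (hκ : 4 < κ) (w : ℝ) :
    κ / 2 * iteratedDeriv 2 (rsGhatW κ) w + 4 * w / (1 + w ^ 2) * deriv (rsGhatW κ) w +
      4 * rsExponent κ / (1 + w ^ 2) ^ 2 * rsGhatW κ w = 0 := by
  rw [iteratedDeriv_two_rsGhatW]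
  exact rsGhatW_ode hκ w

end Slope

end Literature.Probability.RandomPlanarGeometry

end
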